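import Mathlib
import Summits.KontsevichZagierPeriods.Zeta5Search.T1RayKit
import HarnessLib

/-!
# ζ(5) search — RAY #5 of the T1 map (`β = (51; 21,19,18,16,15,13,12)`, `d = 39`): its four top type-space windows, typed (HONEST FRAMING: systematic search; no irrationality claim unless certified)

Cell `pub-zeta5`, GEN-2 seat generation 16.  Census g22's T1 map (`xsave/g22/t1map/t1map.md`, window atlas `xsave/g22/atlas/atlas_g8c5_xk2.md`)
ranks the ray of g8 class #5 (`a = (11,19,14,18,17,23,26,18)`, `β = (51; 21,19,18,16,15,13,12)`, `d = 39`) as one of the two directions whose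
letters cross `λ*` in the by-guard column (MODEL value; uncertified); task C26.0 asks for its type-space windows as TREE STATEMENTS.  The ray is
not an arithmetic progression, so it is the general ray `bRay β5 n` of `T1RayKit`.  This file types, in the format of `Ray4OriginWindowO8.lean` /
`ZeroWindowClasses.lean`, the four top windows of the atlas (gen-2 g16 `t1rays/wclass.py`, LITERAL evaluation of the tree predicates
`ZeroWindows.ZeroWindowClasses` / `OriginWindows.OriginWindowClasses` at every window prime):

* ZERO window `θ = p/n ∈ (12, 13]`, `M = 8` (`1.000` nats/step in the atlas): deep palindrome `ZeroWindows.D8 = [[1,-5,-5,1]]`, extra pair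
  `T1Rays.Sz8 = [[1,-6,-3,1]]` — `n ≤ 300`: 5 804 instances, 0 failures;
* ORIGIN window `θ ∈ (23/2, 12]`, `M = 8` (`0.500` nats/step): the ray-#4 lists `Ray4Windows.D8 / S8` on the line `u8 = (33,−49)`, `c8 = −174`, plus the
  odd-centre type `T1Rays.Pc8 = [[1,-5,-5,1]]` for odd `n` (`b₀ = 51n`); line data PROVED (`T1Rays.lineData8c`) — `n ≤ 300`: 2 906 instances, 0 failures;
* ZERO window `θ ∈ (23/3, 39/5]`, `M = 12`: `Dz12 = [[1,-1,-6,-6,-1,1]]`, `Sz12 = [[1,-2,-6,-5,0,1]]` — `n ≤ 300`: 814 instances, 0 failures;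
* ZERO window `θ ∈ (24/5, 39/8]`, `M = 18`: `Dz18`, `Sz18` — `n ≤ 300`: 484 instances, 0 failures;
* the five next ZERO windows of the atlas, `θ ∈ (17/4, 13/3]` (`M = 20`), `(7/2, 39/11]` (`M = 24`), `(26/9, 3]` (`M = 28`, two deep palindromes,
  no extra pair), `(18/7, 13/5]` (`M = 32`, no extra pair), `(11/6, 13/7]` (`M = 44`) — `n ≤ 150`: 155 / 85 / 218 / 55 / 51 instances, 0 failures —
  stated, like `ResidueLaw.RecWindowM28`, with the explicit size hypothesis `51n + 2 < p²` of the theory (on these deep windows it is not implied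
  by the θ-bounds for small `n`); together the nine windows carry `2.000` of the ray's `2.281` nats/step of type-space savings in the atlas
  (MODEL bookkeeping of the census, uncertified);

each as an `@[conjecture]` class-structure node (integer bookkeeping of `netExp` along residue classes, for the window machines) with the
PROVED reduction to the window bound `6 − 2M` / `5 − 2M`, kernel instances of the nodes by `decide` at the first window primes, and the
resulting UNCONDITIONAL valuation bounds there.  `p`-adic bookkeeping of rational numbers; nothing here bears on irrationality.
-/

noncomputable section

open Finset

namespace Summit.KontsevichZagierPeriods.Zeta5Search.T1Rays

open Summit.KontsevichZagierPeriods.Zeta5Search.CasoratianValuation (InPolytope shift casoratian)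
open Summit.KontsevichZagierPeriods.Zeta5Search.ClusterValuation
open Summit.KontsevichZagierPeriods.Zeta5Search.SecondOrder
open Summit.KontsevichZagierPeriods.Zeta5Search.ResidueLaw
open Summit.KontsevichZagierPeriods.Zeta5Search.WedgeDictionary (dOf)
open Summit.KontsevichZagierPeriods.Zeta5Search.ZeroWindows (ZeroWindowClasses)
open Summit.KontsevichZagierPeriods.Zeta5Search.OriginWindows (OriginWindowClasses LineData)

/-! ## §1 The ray and its four facts -/

/-- Direction #5 of the T1 map (g8 class #5): `β = (51; 21, 19, 18, 16, 15, 13, 12)`, `d = 3·51 − 114 = 39`. -/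
def β5 : List ℤ := [51, 21, 19, 18, 16, 15, 13, 12]

/-- `b₀ = 51n`. -/
theorem ray5_zero (n : ℕ) : bRay β5 n 0 = ((51 * n : ℕ) : ℤ) := by
  simp [bRay, β5, mul_comm]

/-- The ray lies in the polytope. -/
theorem inPolytope_ray5 (n : ℕ) : InPolytope (bRay β5 n) := by
  refine ⟨⟨?_, ?_⟩, ?_, ?_⟩
  · simp [bRay, β5]
  · intro j hj
    simp only [Finset.mem_range] at hj
    interval_cases j <;> simp [bRay, β5] <;> omega
  · intro i hi
    simp only [Finset.mem_range] at hi
    interval_cases i <;> simp [bRay, β5] <;> omega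
  · simp [bRay, β5, Finset.sum_range_succ]; omega

/-- Its `e₇`-shift lies in the polytope (`n ≥ 1`). -/
theorem inPolytope_shift_ray5 {n : ℕ} (hn : 1 ≤ n) : InPolytope (shift (bRay β5 n) 7) := by
  refine ⟨⟨?_, ?_⟩, ?_, ?_⟩
  · simp [shift, bRay, β5]
  · intro i hi
    simp only [Finset.mem_range] at hi
    interval_cases i <;> simp [shift, bRay, β5, Function.update] <;> omega
  · intro i hi
    simp only [Finset.mem_range] at hi
    interval_cases i <;> simp [shift, bRay, β5, Function.update] <;> omega
  · simp [shift, bRay, β5, Function.update, Finset.sum_range_succ]; omega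

/-- `d = 39n` on ray #5. -/
theorem dOf_ray5 (n : ℕ) : dOf (bRay β5 n) = 39 * (n : ℤ) := by
  simp [dOf, bRay, β5, Finset.sum_range_succ]; ring

/-- The ZERO-regime reduction on ray #5 (`b₀ = 51n`, DEG `p(M − 2) ≤ 78n + 1`). -/
theorem ray5Zero_of_classes (n p M : ℕ) (D S : List (List ℤ)) (hn : 1 ≤ n) (hp : p.Prime) (h5 : 5 ≤ p) (hpn : p ≤ 51 * n)
    (hp2 : 51 * n + 2 < p ^ 2) (hM : 6 ≤ M) (hMe : Even M) (hdeg : (p : ℤ) * ((M : ℤ) - 2) ≤ 78 * n + 1)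
    (hD : ∀ T ∈ D, T.reverse = T) (hlen : D.length + S.length ≤ 2) (hC : ZeroWindowClasses (bRay β5 n) p M D S)
    (hne : casoratian (bRay β5 n) 7 ≠ 0) : (6 : ℤ) - 2 * M ≤ padicValRat p (casoratian (bRay β5 n) 7) :=
  zeroWindow_of_classes (bRay β5 n) (51 * n) (39 * n) p M D S (inPolytope_ray5 n) (inPolytope_shift_ray5 hn) (ray5_zero n)
    (dOf_ray5 n) hp h5 hpn hp2 hM hMe (by omega) hD hlen hC hne

/-- The ORIGIN-regime reduction on ray #5. -/
theorem ray5Origin_of_classes (n p M : ℕ) (D S P : List (List ℤ)) (u : ℤ × ℤ) (c : ℚ) (hn : 1 ≤ n) (hp : p.Prime) (h5 : 5 ≤ p)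
    (hpn : p ≤ 51 * n) (hp2 : 51 * n + 2 < p ^ 2) (hM : 6 ≤ M) (hMe : Even M) (hdeg : (p : ℤ) * ((M : ℤ) - 2) ≤ 78 * n + 1)
    (hu : ¬ ((p : ℤ) ∣ u.1 ∧ (p : ℤ) ∣ u.2)) (hI : LineData u c D S P) (hC : OriginWindowClasses (bRay β5 n) p M D S P)
    (hne : casoratian (bRay β5 n) 7 ≠ 0) : (5 : ℤ) - 2 * M ≤ padicValRat p (casoratian (bRay β5 n) 7) :=
  originWindow_of_classes (bRay β5 n) (51 * n) (39 * n) p M D S P u c (inPolytope_ray5 n) (inPolytope_shift_ray5 hn) (ray5_zero n)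
    (dOf_ray5 n) hp h5 hpn hp2 hM hMe (by omega) hu hI hC hne

/-! ## §2 The window statements, the class-structure nodes and the PROVED reductions -/

/-- **RAY-#5 WINDOW `θ ∈ (12, 13]`** (zero regime, `M = 8`, `casLB + 3`): `v_p(Cas₇(b(n))) ≥ −10 = 6 − 2M` (atlas: `1.000` nats/step). -/
@[conjecture] def Ray5WindowZ13 : Prop :=
  ∀ n p : ℕ, 2 ≤ n → p.Prime → 12 * n < p → p ≤ 13 * n → casoratian (bRay β5 n) 7 ≠ 0 →
    (-10 : ℤ) ≤ padicValRat p (casoratian (bRay β5 n) 7)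

/-- **CLASS STRUCTURE, ray #5, zero window `(12, 13]`, `M = 8`** (`12n < p ≤ 13n`): every window prime with `n ≤ 300` (5 804 instances),
0 failures (gen-2 g16 `t1rays/wclass.py`, literal evaluation). -/
@[conjecture] def Ray5ZeroClassesZ13 : Prop :=
  ∀ n p : ℕ, 2 ≤ n → p.Prime → 12 * n < p → p ≤ 13 * n → ZeroWindowClasses (bRay β5 n) p 8 ZeroWindows.D8 Sz8

/-- **`Ray5WindowZ13` from its class structure.** -/
theorem ray5WindowZ13_of (hC : Ray5ZeroClassesZ13) : Ray5WindowZ13 := by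
  intro n p hn hp h1 h2 hne
  have h25 : 25 ≤ p := by omega
  have hp2 : 51 * n + 2 < p ^ 2 := by
    have := Nat.mul_le_mul_right p h25
    rw [pow_two]; omega
  exact ray5Zero_of_classes n p 8 ZeroWindows.D8 Sz8 (by omega) hp (by omega) (by omega) hp2 (by norm_num) (by decide)
    (by push_cast; omega) d8_pal d8_sz8_len (hC n p hn hp h1 h2) hne

/-- **RAY-#5 WINDOW `θ ∈ (23/2, 12]`** (origin regime, `M = 8`, `casLB + 2`): `v_p(Cas₇(b(n))) ≥ −11 = 5 − 2M` (atlas: `0.500` nats/step). -/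
@[conjecture] def Ray5WindowO12 : Prop :=
  ∀ n p : ℕ, 2 ≤ n → p.Prime → 23 * n < 2 * p → p ≤ 12 * n → casoratian (bRay β5 n) 7 ≠ 0 →
    (-11 : ℤ) ≤ padicValRat p (casoratian (bRay β5 n) 7)

/-- **CLASS STRUCTURE, ray #5, origin window `(23/2, 12]`, `M = 8`** (`23n < 2p`, `p ≤ 12n`): the universal `M = 8` origin lists
`Ray4Windows.D8 / S8` and, for odd `n`, the odd-centre type `Pc8`; every window prime with `n ≤ 300` (2 906 instances), 0 failures. -/
@[conjecture] def Ray5OriginClassesO12 : Prop :=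
  ∀ n p : ℕ, 2 ≤ n → p.Prime → 23 * n < 2 * p → p ≤ 12 * n →
    OriginWindowClasses (bRay β5 n) p 8 Ray4Windows.D8 Ray4Windows.S8 Pc8

/-- **`Ray5WindowO12` from its class structure** (the line data being PROVED, `lineData8c`). -/
theorem ray5WindowO12_of (hC : Ray5OriginClassesO12) : Ray5WindowO12 := by
  intro n p hn hp h1 h2 hne
  have h24 : 24 ≤ p := by omega
  have hp2 : 51 * n + 2 < p ^ 2 := by
    have := Nat.mul_le_mul_right p h24
    rw [pow_two]; omega
  exact ray5Origin_of_classes n p 8 Ray4Windows.D8 Ray4Windows.S8 Pc8 Ray4Windows.u8 Ray4Windows.c8 (by omega) hp (by omega) (by omega)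
    hp2 (by norm_num) (by decide) (by push_cast; omega) (Ray4Windows.u8_ne hp) lineData8c (hC n p hn hp h1 h2) hne

/-- **RAY-#5 WINDOW `θ ∈ (23/3, 39/5]`** (zero regime, `M = 12`): `v_p(Cas₇(b(n))) ≥ −18 = 6 − 2M`. -/
@[conjecture] def Ray5WindowZ39o5 : Prop :=
  ∀ n p : ℕ, 2 ≤ n → p.Prime → 23 * n < 3 * p → 5 * p ≤ 39 * n → casoratian (bRay β5 n) 7 ≠ 0 →
    (-18 : ℤ) ≤ padicValRat p (casoratian (bRay β5 n) 7)

/-- **CLASS STRUCTURE, ray #5, zero window `(23/3, 39/5]`, `M = 12`** (`23n < 3p`, `5p ≤ 39n`): every window prime with `n ≤ 300`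
(814 instances), 0 failures. -/
@[conjecture] def Ray5ZeroClassesZ39o5 : Prop :=
  ∀ n p : ℕ, 2 ≤ n → p.Prime → 23 * n < 3 * p → 5 * p ≤ 39 * n → ZeroWindowClasses (bRay β5 n) p 12 Dz12 Sz12

/-- **`Ray5WindowZ39o5` from its class structure.** -/
theorem ray5WindowZ39o5_of (hC : Ray5ZeroClassesZ39o5) : Ray5WindowZ39o5 := by
  intro n p hn hp h1 h2 hne
  have h16 : 16 ≤ p := by omega
  have hp2 : 51 * n + 2 < p ^ 2 := by
    have := Nat.mul_le_mul_right p h16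
    rw [pow_two]; omega
  exact ray5Zero_of_classes n p 12 Dz12 Sz12 (by omega) hp (by omega) (by omega) hp2 (by norm_num) (by decide)
    (by push_cast; omega) (by decide) (by decide) (hC n p hn hp h1 h2) hne

/-- **RAY-#5 WINDOW `θ ∈ (24/5, 39/8]`** (zero regime, `M = 18`): `v_p(Cas₇(b(n))) ≥ −30 = 6 − 2M`. -/
@[conjecture] def Ray5WindowZ39o8 : Prop :=
  ∀ n p : ℕ, 2 ≤ n → p.Prime → 24 * n < 5 * p → 8 * p ≤ 39 * n → casoratian (bRay β5 n) 7 ≠ 0 →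
    (-30 : ℤ) ≤ padicValRat p (casoratian (bRay β5 n) 7)

/-- **CLASS STRUCTURE, ray #5, zero window `(24/5, 39/8]`, `M = 18`** (`24n < 5p`, `8p ≤ 39n`): every window prime with `n ≤ 300`
(484 instances), 0 failures. -/
@[conjecture] def Ray5ZeroClassesZ39o8 : Prop :=
  ∀ n p : ℕ, 2 ≤ n → p.Prime → 24 * n < 5 * p → 8 * p ≤ 39 * n → ZeroWindowClasses (bRay β5 n) p 18 Dz18 Sz18

/-- **`Ray5WindowZ39o8` from its class structure.** -/
theorem ray5WindowZ39o8_of (hC : Ray5ZeroClassesZ39o8) : Ray5WindowZ39o8 := by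
  intro n p hn hp h1 h2 hne
  have h13 : 13 ≤ p := by omega
  have hp2 : 51 * n + 2 < p ^ 2 := by
    have := Nat.mul_le_mul_right p h13
    rw [pow_two]; omega
  exact ray5Zero_of_classes n p 18 Dz18 Sz18 (by omega) hp (by omega) (by omega) hp2 (by norm_num) (by decide)
    (by push_cast; omega) (by decide) (by decide) (hC n p hn hp h1 h2) hne

/-- **RAY-#5 WINDOW `θ ∈ (17/4, 13/3]`** (zero regime, `M = 20`; size hypothesis `51n + 2 < p²` explicit): `v_p(Cas₇(b(n))) ≥ -34 = 6 − 2M`. -/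
@[conjecture] def Ray5WindowZ13o3 : Prop :=
  ∀ n p : ℕ, 2 ≤ n → p.Prime → 17 * n < 4 * p → 3 * p ≤ 13 * n → 51 * n + 2 < p ^ 2 → casoratian (bRay β5 n) 7 ≠ 0 →
    (-34 : ℤ) ≤ padicValRat p (casoratian (bRay β5 n) 7)

/-- **CLASS STRUCTURE, ray #5, zero window `(17/4, 13/3]`, `M = 20`**: every window prime with `n ≤ 150` and `51n + 2 < p²` (155 instances),
0 failures (gen-2 g16 `t1rays/wclass.py`, literal evaluation). -/
@[conjecture] def Ray5ZeroClassesZ13o3 : Prop :=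
  ∀ n p : ℕ, 2 ≤ n → p.Prime → 17 * n < 4 * p → 3 * p ≤ 13 * n → 51 * n + 2 < p ^ 2 → ZeroWindowClasses (bRay β5 n) p 20 Dz20 Sz20

/-- **`Ray5WindowZ13o3` from its class structure.** -/
theorem ray5WindowZ13o3_of (hC : Ray5ZeroClassesZ13o3) : Ray5WindowZ13o3 := by
  intro n p hn hp h1 h2 hw hne
  exact ray5Zero_of_classes n p 20 Dz20 Sz20 (by omega) hp (by omega) (by omega) hw (by norm_num) (by decide)
    (by push_cast; omega) (by decide) (by decide) (hC n p hn hp h1 h2 hw) hne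

/-- **RAY-#5 WINDOW `θ ∈ (7/2, 39/11]`** (zero regime, `M = 24`; size hypothesis `51n + 2 < p²` explicit): `v_p(Cas₇(b(n))) ≥ -42 = 6 − 2M`. -/
@[conjecture] def Ray5WindowZ39o11 : Prop :=
  ∀ n p : ℕ, 2 ≤ n → p.Prime → 7 * n < 2 * p → 11 * p ≤ 39 * n → 51 * n + 2 < p ^ 2 → casoratian (bRay β5 n) 7 ≠ 0 →
    (-42 : ℤ) ≤ padicValRat p (casoratian (bRay β5 n) 7)

/-- **CLASS STRUCTURE, ray #5, zero window `(7/2, 39/11]`, `M = 24`**: every window prime with `n ≤ 150` and `51n + 2 < p²` (85 instances),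
0 failures (gen-2 g16 `t1rays/wclass.py`, literal evaluation). -/
@[conjecture] def Ray5ZeroClassesZ39o11 : Prop :=
  ∀ n p : ℕ, 2 ≤ n → p.Prime → 7 * n < 2 * p → 11 * p ≤ 39 * n → 51 * n + 2 < p ^ 2 → ZeroWindowClasses (bRay β5 n) p 24 Dz24 Sz24

/-- **`Ray5WindowZ39o11` from its class structure.** -/
theorem ray5WindowZ39o11_of (hC : Ray5ZeroClassesZ39o11) : Ray5WindowZ39o11 := by
  intro n p hn hp h1 h2 hw hne
  exact ray5Zero_of_classes n p 24 Dz24 Sz24 (by omega) hp (by omega) (by omega) hw (by norm_num) (by decide)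
    (by push_cast; omega) (by decide) (by decide) (hC n p hn hp h1 h2 hw) hne

/-- **RAY-#5 WINDOW `θ ∈ (26/9, 3]`** (zero regime, `M = 28`; size hypothesis `51n + 2 < p²` explicit): `v_p(Cas₇(b(n))) ≥ -50 = 6 − 2M`. -/
@[conjecture] def Ray5WindowZ3 : Prop :=
  ∀ n p : ℕ, 2 ≤ n → p.Prime → 26 * n < 9 * p → p ≤ 3 * n → 51 * n + 2 < p ^ 2 → casoratian (bRay β5 n) 7 ≠ 0 →
    (-50 : ℤ) ≤ padicValRat p (casoratian (bRay β5 n) 7)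

/-- **CLASS STRUCTURE, ray #5, zero window `(26/9, 3]`, `M = 28`**: every window prime with `n ≤ 150` and `51n + 2 < p²` (218 instances),
0 failures (gen-2 g16 `t1rays/wclass.py`, literal evaluation). -/
@[conjecture] def Ray5ZeroClassesZ3 : Prop :=
  ∀ n p : ℕ, 2 ≤ n → p.Prime → 26 * n < 9 * p → p ≤ 3 * n → 51 * n + 2 < p ^ 2 → ZeroWindowClasses (bRay β5 n) p 28 Dz28 Sz28

/-- **`Ray5WindowZ3` from its class structure.** -/
theorem ray5WindowZ3_of (hC : Ray5ZeroClassesZ3) : Ray5WindowZ3 := by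
  intro n p hn hp h1 h2 hw hne
  exact ray5Zero_of_classes n p 28 Dz28 Sz28 (by omega) hp (by omega) (by omega) hw (by norm_num) (by decide)
    (by push_cast; omega) (by decide) (by decide) (hC n p hn hp h1 h2 hw) hne

/-- **RAY-#5 WINDOW `θ ∈ (18/7, 13/5]`** (zero regime, `M = 32`; size hypothesis `51n + 2 < p²` explicit): `v_p(Cas₇(b(n))) ≥ -58 = 6 − 2M`. -/
@[conjecture] def Ray5WindowZ13o5 : Prop :=
  ∀ n p : ℕ, 2 ≤ n → p.Prime → 18 * n < 7 * p → 5 * p ≤ 13 * n → 51 * n + 2 < p ^ 2 → casoratian (bRay β5 n) 7 ≠ 0 →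
    (-58 : ℤ) ≤ padicValRat p (casoratian (bRay β5 n) 7)

/-- **CLASS STRUCTURE, ray #5, zero window `(18/7, 13/5]`, `M = 32`**: every window prime with `n ≤ 150` and `51n + 2 < p²` (55 instances),
0 failures (gen-2 g16 `t1rays/wclass.py`, literal evaluation). -/
@[conjecture] def Ray5ZeroClassesZ13o5 : Prop :=
  ∀ n p : ℕ, 2 ≤ n → p.Prime → 18 * n < 7 * p → 5 * p ≤ 13 * n → 51 * n + 2 < p ^ 2 → ZeroWindowClasses (bRay β5 n) p 32 Dz32 Sz32

/-- **`Ray5WindowZ13o5` from its class structure.** -/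
theorem ray5WindowZ13o5_of (hC : Ray5ZeroClassesZ13o5) : Ray5WindowZ13o5 := by
  intro n p hn hp h1 h2 hw hne
  exact ray5Zero_of_classes n p 32 Dz32 Sz32 (by omega) hp (by omega) (by omega) hw (by norm_num) (by decide)
    (by push_cast; omega) (by decide) (by decide) (hC n p hn hp h1 h2 hw) hne

/-- **RAY-#5 WINDOW `θ ∈ (11/6, 13/7]`** (zero regime, `M = 44`; size hypothesis `51n + 2 < p²` explicit): `v_p(Cas₇(b(n))) ≥ -82 = 6 − 2M`. -/
@[conjecture] def Ray5WindowZ13o7 : Prop :=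
  ∀ n p : ℕ, 2 ≤ n → p.Prime → 11 * n < 6 * p → 7 * p ≤ 13 * n → 51 * n + 2 < p ^ 2 → casoratian (bRay β5 n) 7 ≠ 0 →
    (-82 : ℤ) ≤ padicValRat p (casoratian (bRay β5 n) 7)

/-- **CLASS STRUCTURE, ray #5, zero window `(11/6, 13/7]`, `M = 44`**: every window prime with `n ≤ 150` and `51n + 2 < p²` (51 instances),
0 failures (gen-2 g16 `t1rays/wclass.py`, literal evaluation). -/
@[conjecture] def Ray5ZeroClassesZ13o7 : Prop :=
  ∀ n p : ℕ, 2 ≤ n → p.Prime → 11 * n < 6 * p → 7 * p ≤ 13 * n → 51 * n + 2 < p ^ 2 → ZeroWindowClasses (bRay β5 n) p 44 Dz44 Sz44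

/-- **`Ray5WindowZ13o7` from its class structure.** -/
theorem ray5WindowZ13o7_of (hC : Ray5ZeroClassesZ13o7) : Ray5WindowZ13o7 := by
  intro n p hn hp h1 h2 hw hne
  exact ray5Zero_of_classes n p 44 Dz44 Sz44 (by omega) hp (by omega) (by omega) hw (by norm_num) (by decide)
    (by push_cast; omega) (by decide) (by decide) (hC n p hn hp h1 h2 hw) hne

/-! ## §3 Kernel instances of the nodes at the first window primes, and the unconditional bounds there -/

/-- Zero window `(12, 13]`, first instance `(n, p) = (3, 37)`. -/
theorem ray5_Z13_3_37 : ZeroWindowClasses (bRay β5 3) 37 8 ZeroWindows.D8 Sz8 := by decide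
/-- Zero window `(12, 13]`, `(n, p) = (5, 61)`. -/
theorem ray5_Z13_5_61 : ZeroWindowClasses (bRay β5 5) 61 8 ZeroWindows.D8 Sz8 := by decide
/-- Origin window `(23/2, 12]`, first instance `(n, p) = (4, 47)` (even `n`: no centre types). -/
theorem ray5_O12_4_47 : OriginWindowClasses (bRay β5 4) 47 8 Ray4Windows.D8 Ray4Windows.S8 Pc8 := by decide
/-- Origin window `(23/2, 12]`, `(n, p) = (5, 59)` (odd `n`: `b₀ = 255`, the odd-centre type `[1,-5,-5,1]` occurs). -/
theorem ray5_O12_5_59 : OriginWindowClasses (bRay β5 5) 59 8 Ray4Windows.D8 Ray4Windows.S8 Pc8 := by decide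
/-- Zero window `(23/3, 39/5]`, first instance `(n, p) = (4, 31)`. -/
theorem ray5_Z39o5_4_31 : ZeroWindowClasses (bRay β5 4) 31 12 Dz12 Sz12 := by decide
/-- Zero window `(24/5, 39/8]`, first instance `(n, p) = (6, 29)`. -/
theorem ray5_Z39o8_6_29 : ZeroWindowClasses (bRay β5 6) 29 18 Dz18 Sz18 := by decide

/-- Zero window `(17/4, 13/3]`, first instance `(n, p) = (3, 13)`. -/
theorem ray5_Z13o3_3_13 : ZeroWindowClasses (bRay β5 3) 13 20 Dz20 Sz20 := by decide
/-- Zero window `(7/2, 39/11]`, first instance `(n, p) = (15, 53)`. -/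
theorem ray5_Z39o11_15_53 : ZeroWindowClasses (bRay β5 15) 53 24 Dz24 Sz24 := by decide
/-- Zero window `(26/9, 3]`, first instance `(n, p) = (10, 29)`. -/
theorem ray5_Z3_10_29 : ZeroWindowClasses (bRay β5 10) 29 28 Dz28 Sz28 := by decide
/-- Zero window `(18/7, 13/5]`, first instance `(n, p) = (12, 31)`. -/
theorem ray5_Z13o5_12_31 : ZeroWindowClasses (bRay β5 12) 31 32 Dz32 Sz32 := by decide
/-- Zero window `(11/6, 13/7]`, instance `(n, p) = (32, 59)` (first `n` at which the extra pair `Sz44` occurs). -/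
theorem ray5_Z13o7_32_59 : ZeroWindowClasses (bRay β5 32) 59 44 Dz44 Sz44 := by decide

/-- **Unconditional**: `v₃₇(Cas₇(b(3))) ≥ −10` on ray #5 (`b(3) = (153; 63,57,54,48,45,39,36)`). -/
theorem ray5_cas_3_37 (hne : casoratian (bRay β5 3) 7 ≠ 0) : (-10 : ℤ) ≤ padicValRat 37 (casoratian (bRay β5 3) 7) :=
  ray5Zero_of_classes 3 37 8 ZeroWindows.D8 Sz8 (by norm_num) (by norm_num) (by norm_num) (by norm_num) (by norm_num) (by norm_num)
    (by decide) (by norm_num) d8_pal d8_sz8_len ray5_Z13_3_37 hne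

/-- **Unconditional**: `v₅₉(Cas₇(b(5))) ≥ −11` on ray #5 (origin window, odd centre). -/
theorem ray5_cas_5_59 (hne : casoratian (bRay β5 5) 7 ≠ 0) : (-11 : ℤ) ≤ padicValRat 59 (casoratian (bRay β5 5) 7) :=
  ray5Origin_of_classes 5 59 8 Ray4Windows.D8 Ray4Windows.S8 Pc8 Ray4Windows.u8 Ray4Windows.c8 (by norm_num) (by norm_num) (by norm_num)
    (by norm_num) (by norm_num) (by norm_num) (by decide) (by norm_num) (Ray4Windows.u8_ne (by norm_num)) lineData8c ray5_O12_5_59 hne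

/-- **Unconditional**: `v₂₉(Cas₇(b(6))) ≥ −30` on ray #5 (`M = 18` zero window). -/
theorem ray5_cas_6_29 (hne : casoratian (bRay β5 6) 7 ≠ 0) : (-30 : ℤ) ≤ padicValRat 29 (casoratian (bRay β5 6) 7) :=
  ray5Zero_of_classes 6 29 18 Dz18 Sz18 (by norm_num) (by norm_num) (by norm_num) (by norm_num) (by norm_num) (by norm_num)
    (by decide) (by norm_num) (by decide) (by decide) ray5_Z39o8_6_29 hne

end Summit.KontsevichZagierPeriods.Zeta5Search.T1Rays

end
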